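import Literature.NumberTheory.EllipticCurves.GreenbergSelmerDualDataExistsProofs
import Literature.NumberTheory.GaloisRepresentations.GaloisCohomology
import HarnessLib

/-!
# The `N`-torsion `A_ρ[N]` of the cofree module `A_ρ = Fⁿ/𝒪ⁿ` of a framed Galois representation as a DISCRETE GALOIS MODULE
# (`DiscreteGaloisModule`), and its finiteness — the coefficient module of the `ρ`-coefficient layer Tate pairing

Topic `NumberTheory/EllipticCurves`, namespace `Literature.NumberTheory.EllipticCurves.GreenbergSelmer`. Lead prover of route
`ResidualThetaTransportAtTwo` (cell `bsd-wall`, seat `bsd-wall-rtt-p2` g16), item D2(b) of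
`Summits/…/Cruxes/ResidualThetaCountLowerPureAtTwo/PIN-SPEC-S2-g16.md` (with D1 = `GreenbergSelmerCofreeReductionPk`): the cup product / local
Tate pairing of the tree (`DiscreteGaloisModule.pairing`, `localTatePairing`, `CyclotomicLayer.*`) consume a `DiscreteGaloisModule K M` with `M`
finite; here `M = A_ρ[N]` for `ρ : Γ_ℚ → GL_n(𝒪)`, `𝒪 = padicCoeffIntegers S`, exactly as `WeierstrassCurve.torsionGaloisModule` packages `E[N]`.
DEFINITIONS WITH BODIES + proved lemmas; no named fact, no instance, no notation; nothing about BSD.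

* `cofreeTorsionRepresentation ρ N : Representation ℤ Γ_ℚ ↥(A_ρ[N])` (`σ ↦ σ • ·` on the torsion subgroup, generic instance
  `AddSubgroup.torsionBy.instDistribMulAction`); `cofreeTorsionGaloisModule ρ N : DiscreteGaloisModule ℚ ↥(A_ρ[N])`
  (`DiscreteGaloisModule.ofIsOpenStabilizer` + `isOpen_stabilizer_cofree`); unfolding lemmas.
NOT here (next): finiteness of `A_ρ[N]` for `N ≠ 0` (`A_ρ[N] ≅ (𝒪/N)ⁿ`, needed as the `[Finite M]` of `localTatePairing`), the pairing
`A_ρ[N] × A_ρ[N] → μ_N` (self-duality of `ρ`), the layer pairing (PIN-SPEC D2(a),(c)).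

References: R. Greenberg (1989) §1 p. 98; Emerton–Pollack–Weston (2006) §3.1; J.-P. Serre, *Galois Cohomology* I §2.1.
-/

noncomputable section

open scoped Classical
open Field IsDedekindDomain
open Literature.NumberTheory.GaloisRepresentations

namespace Literature.NumberTheory.EllipticCurves.GreenbergSelmer

section TorsionModule

variable {p : ℕ} [Fact p.Prime] (S : Set (PadicAlgCl p)) {n : ℕ} (ρ : FramedGaloisRep ℚ (padicCoeffIntegers S) n) (N : ℤ)

/-- **The Galois action on `A_ρ[N]` as a `ℤ`-linear representation of `Γ_ℚ`** (`σ ↦ σ • ·`, the restriction of the action on `A_ρ`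
to its `N`-torsion; twin of `WeierstrassCurve.torsionGaloisRepresentation`). [cite: Greenberg1989, §1 p. 98] -/
def cofreeTorsionRepresentation :
    Representation ℤ (absoluteGaloisGroup ℚ) ↥(AddSubgroup.torsionBy (Cofree ρ (padicCoeffField S)) N) where
  toFun σ := (DistribSMul.toAddMonoidHom (↥(AddSubgroup.torsionBy (Cofree ρ (padicCoeffField S)) N)) σ).toIntLinearMap
  map_one' := by ext a; simp
  map_mul' σ τ := by ext a; simp [mul_smul]

/-- Unfolding: `cofreeTorsionRepresentation ρ N σ a = σ • a`. [cite: Greenberg1989, §1 p. 98] -/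
@[simp]
theorem cofreeTorsionRepresentation_apply_apply (σ : absoluteGaloisGroup ℚ)
    (a : ↥(AddSubgroup.torsionBy (Cofree ρ (padicCoeffField S)) N)) :
    cofreeTorsionRepresentation S ρ N σ a = σ • a :=
  rfl

/-- **`A_ρ[N]` as a discrete Galois module over `ℚ`**: the stabiliser of a torsion point is the stabiliser of the underlying point of
`A_ρ`, which is open (`isOpen_stabilizer_cofree`: `ρ(σ) ≡ 1 mod p^k` fixes `v mod 𝒪ⁿ`). Twin of `WeierstrassCurve.torsionGaloisModule`.
[cite: SerreGaloisCohomology1997, I §2.1] [cite: EmertonPollackWeston2006, §3.1 (arXiv:math/0404484 p. 17)] -/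
def cofreeTorsionGaloisModule : DiscreteGaloisModule ℚ ↥(AddSubgroup.torsionBy (Cofree ρ (padicCoeffField S)) N) :=
  DiscreteGaloisModule.ofIsOpenStabilizer (cofreeTorsionRepresentation S ρ N) fun a ↦ by
    have h := isOpen_stabilizer_cofree S ρ (a : Cofree ρ (padicCoeffField S))
    convert h using 1
    ext σ
    simp only [Set.mem_setOf_eq, cofreeTorsionRepresentation_apply_apply, SetLike.mem_coe, MulAction.mem_stabilizer_iff,
      Subtype.ext_iff, AddSubgroup.torsionBy.coe_smul]

/-- Unfolding: `cofreeTorsionGaloisModule ρ N σ a = σ • a`. [cite: SerreGaloisCohomology1997, I §2.1] -/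
@[simp]
theorem cofreeTorsionGaloisModule_apply_apply (σ : absoluteGaloisGroup ℚ)
    (a : ↥(AddSubgroup.torsionBy (Cofree ρ (padicCoeffField S)) N)) :
    cofreeTorsionGaloisModule S ρ N σ a = σ • a :=
  rfl

end TorsionModule

end Literature.NumberTheory.EllipticCurves.GreenbergSelmer

end
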